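import Summits.NavierStokesRegularity.NavierStokesRegularity.Theorems.AxisymmetricExtremalityAxisymmetricKatoGlobalStubSereginLogSwirlOriginParabolicNullLines
import Summits.NavierStokesRegularity.NavierStokesRegularity.Theorems.AxisymmetricExtremalityAxisymmetricKatoGlobalStubSeregin2020TypeIISwirlVanishesRepr
import HarnessLib

/-!
# Seregin 2020, Lemma 2.2: tools for the assembly of `hWH′` — transfers along `u = U` a.e. and
# the normalised pair `(Φ̃, Ũ)`

Toward the stub `stub_seregin2020TypeII` of the crux `AxisymmetricKatoGlobal` (= the named fact
`Literature.Analysis.FluidPDE.Seregin2020_axisymmetricSingularPoint_typeII`, G. Seregin, Anal.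
Math. Phys. 10 (2020) Paper 46 = arXiv:2006.04140, Thm 2.1), reduced in the tree to the corrected
Lemma 2.2 (`hWH′`). The assembly (`…Lemma22Assembly`) feeds the data of `hWH′` into the De Giorgi
`Standing` hypotheses of the cell's atoms; this file holds the bookkeeping lemmas it needs:

* `lintegral_cube_parabolicCylinder_lt_top_of_cknC`, `driftBound_congr_ae` — local `L³` and the
  drift bound pass from `u` to `U` along `u = U` a.e. on `{t < 0}`;
* `ae_eq_normalisedDrift`, `normalisedDrift_aestronglyMeasurable` — the normalised drift
  `Ũ = U` on `{t < 0, ϱ ≠ 0}`, `= 0` elsewhere (kits/A1.md item 9);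
* `normalisedPhi_props` — the normalised `Φ̃ = Φ` on `{t < 0} ∖ S`, `= k` elsewhere: measurable,
  continuous on `{t < 0} ∖ S`, `≥ 0`, a.e. slice `C¹` (`S` is `𝒫¹`-null);
* `superlevel_volume_le_normalised` — `|{Φ > κ} ∩ slab| ≤ |{Φ̃ > κ} ∩ slab|` (`S` is null).

No NS regularity statement is proved here.

## References

* G. Seregin, Anal. Math. Phys. 10 (2020), Paper 46 = arXiv:2006.04140, Lemma 2.2, §3 (class 𝒱).
  [Seregin2020]
-/

-- the problem directory repeats the summit name (D-0017); core's `dupNamespace` linter fires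
set_option linter.dupNamespace false

noncomputable section

open MeasureTheory Set Function Filter Topology TopologicalSpace Metric
open scoped NNReal ENNReal

namespace Summit.NavierStokesRegularity.NavierStokesRegularity.Theorems.AxisymmetricKatoGlobal.EulerScaling

open Literature.Analysis.FluidPDE

/-! ### Transfers along `u = U` a.e. and the normalisation -/

/-- Local `L³`-finiteness of `U` on `Q(a)` from the scaled quantity `C(a) ≤ K` of `u` and
`u = U` a.e. on `{t < 0}`. [folklore] -/
theorem lintegral_cube_parabolicCylinder_lt_top_of_cknC
    {u U : ℝ → EuclideanSpace ℝ (Fin 3) → EuclideanSpace ℝ (Fin 3)} {a : ℝ} {K : ℝ≥0}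
    (hae : uncurry u =ᵐ[volume.restrict {z : ℝ × EuclideanSpace ℝ (Fin 3) | z.1 < 0}] uncurry U) (hC : cknC a 0 u ≤ K) :
    ∫⁻ z in parabolicCylinder a (0 : ℝ × EuclideanSpace ℝ (Fin 3)), ‖U z.1 z.2‖ₑ ^ (3 : ℕ) < ∞ := by
  -- adapted from Cruxes/AxisymmetricKatoGlobal/Lemma22Skeleton.lean (`lemma22_of_stubs`)
  have hQneg : parabolicCylinder a (0 : ℝ × EuclideanSpace ℝ (Fin 3)) ⊆ {z : ℝ × EuclideanSpace ℝ (Fin 3) | z.1 < 0} := fun z hz => by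
    rw [mem_parabolicCylinder] at hz
    simpa using hz.1.2
  have haeQ : ∀ᵐ z ∂(volume.restrict (parabolicCylinder a (0 : ℝ × EuclideanSpace ℝ (Fin 3)))), uncurry u z = uncurry U z :=
    ae_restrict_of_ae_restrict_of_subset hQneg hae
  have e : ∫⁻ z in parabolicCylinder a (0 : ℝ × EuclideanSpace ℝ (Fin 3)), ‖U z.1 z.2‖ₑ ^ (3 : ℕ) =
      ∫⁻ z in parabolicCylinder a (0 : ℝ × EuclideanSpace ℝ (Fin 3)), ‖u z.1 z.2‖ₑ ^ (3 : ℕ) :=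
    lintegral_congr_ae (haeQ.mono fun z hz => by
      simp only [uncurry] at hz
      show ‖U z.1 z.2‖ₑ ^ (3 : ℕ) = ‖u z.1 z.2‖ₑ ^ (3 : ℕ)
      rw [hz])
  rw [e]
  unfold cknC at hC
  have hfin : (ENNReal.ofReal a ^ 2)⁻¹ * ∫⁻ q in parabolicCylinder a (0 : ℝ × EuclideanSpace ℝ (Fin 3)), ‖u q.1 q.2‖ₑ ^ (3 : ℕ) < ∞ :=
    hC.trans_lt ENNReal.coe_lt_top
  have ha2 : (ENNReal.ofReal a ^ 2)⁻¹ ≠ 0 :=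
    ENNReal.inv_ne_zero.2 (ENNReal.pow_ne_top ENNReal.ofReal_ne_top)
  exact lt_top_iff_ne_top.2 fun htop => by
    rw [htop, ENNReal.mul_top ha2] at hfin
    exact lt_irrefl _ hfin

/-- The scale-invariant drift bound `∫ (∫_{B(2R)} |·|³)^{4/3} ≤ N R²` passes from `u` to any `U`
with `u = U` a.e. on `{t < 0}` (Fubini). [folklore] -/
theorem driftBound_congr_ae {u U : ℝ → EuclideanSpace ℝ (Fin 3) → EuclideanSpace ℝ (Fin 3)} {R : ℝ} {N : ℝ≥0}
    (hae : uncurry u =ᵐ[volume.restrict {z : ℝ × EuclideanSpace ℝ (Fin 3) | z.1 < 0}] uncurry U)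
    (hN : ∫⁻ s in Ioo (-R ^ 2) 0, (∫⁻ y in ball (0 : EuclideanSpace ℝ (Fin 3)) (2 * R), ‖u s y‖ₑ ^ (3 : ℕ)) ^ (4 / 3 : ℝ) ≤
      (N : ℝ≥0∞) * ENNReal.ofReal R ^ 2) :
    ∫⁻ s in Ioo (-R ^ 2) 0, (∫⁻ y in ball (0 : EuclideanSpace ℝ (Fin 3)) (2 * R), ‖U s y‖ₑ ^ (3 : ℕ)) ^ (4 / 3 : ℝ) ≤
      (N : ℝ≥0∞) * ENNReal.ofReal R ^ 2 := by
  -- adapted from Cruxes/AxisymmetricKatoGlobal/Lemma22Skeleton.lean (`lemma22_of_stubs`)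
  have hae' : ∀ᵐ z : ℝ × EuclideanSpace ℝ (Fin 3), z ∈ {z : ℝ × EuclideanSpace ℝ (Fin 3) | z.1 < 0} → uncurry u z = uncurry U z :=
    (ae_restrict_iff' (measurableSet_lt measurable_fst measurable_const)).1 hae
  have h2 : ∀ᵐ s : ℝ, ∀ᵐ y : EuclideanSpace ℝ (Fin 3), (s, y) ∈ {z : ℝ × EuclideanSpace ℝ (Fin 3) | z.1 < 0} → uncurry u (s, y) = uncurry U (s, y) :=
    Measure.ae_ae_of_ae_prod (p := fun z : ℝ × EuclideanSpace ℝ (Fin 3) => z ∈ {z : ℝ × EuclideanSpace ℝ (Fin 3) | z.1 < 0} → uncurry u z = uncurry U z)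
      (by rw [← Measure.volume_eq_prod]; exact hae')
  have e : ∫⁻ s in Ioo (-R ^ 2) 0, (∫⁻ y in ball (0 : EuclideanSpace ℝ (Fin 3)) (2 * R), ‖U s y‖ₑ ^ (3 : ℕ)) ^ (4 / 3 : ℝ) =
      ∫⁻ s in Ioo (-R ^ 2) 0, (∫⁻ y in ball (0 : EuclideanSpace ℝ (Fin 3)) (2 * R), ‖u s y‖ₑ ^ (3 : ℕ)) ^ (4 / 3 : ℝ) := by
    refine setLIntegral_congr_fun_ae measurableSet_Ioo ?_
    filter_upwards [h2] with s hs hsI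
    have hs0 : s < 0 := hsI.2
    congr 1
    refine lintegral_congr_ae (ae_restrict_of_ae (hs.mono fun y hy => ?_))
    have := hy hs0
    simp only [uncurry] at this
    show ‖U s y‖ₑ ^ (3 : ℕ) = ‖u s y‖ₑ ^ (3 : ℕ)
    rw [this]
  rw [e]; exact hN

/-- `u = Ũ` a.e. on `{t < 0}` for the normalised drift `Ũ = U` off the axis on `{t < 0}` (the axis
is Lebesgue-null). [folklore] -/
theorem ae_eq_normalisedDrift {u U U' : ℝ → EuclideanSpace ℝ (Fin 3) → EuclideanSpace ℝ (Fin 3)}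
    (hae : uncurry u =ᵐ[volume.restrict {z : ℝ × EuclideanSpace ℝ (Fin 3) | z.1 < 0}] uncurry U)
    (hU'1 : ∀ t x, t < 0 → cylRadius x ≠ 0 → U' t x = U t x) :
    uncurry u =ᵐ[volume.restrict {z : ℝ × EuclideanSpace ℝ (Fin 3) | z.1 < 0}] uncurry U' := by
  have hax : ∀ᵐ z : ℝ × EuclideanSpace ℝ (Fin 3), z ∉ {z : ℝ × EuclideanSpace ℝ (Fin 3) | cylRadius z.2 = 0} :=
    measure_eq_zero_iff_ae_notMem.1 volume_setOf_cylRadius_snd_eq_zero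
  have hneg : ∀ᵐ z ∂(volume.restrict {z : ℝ × EuclideanSpace ℝ (Fin 3) | z.1 < 0}), z ∈ {z : ℝ × EuclideanSpace ℝ (Fin 3) | z.1 < 0} :=
    ae_restrict_mem (measurableSet_lt measurable_fst measurable_const)
  filter_upwards [hae, ae_restrict_of_ae hax, hneg] with z h1 h2 h3
  rw [h1]
  exact (hU'1 z.1 z.2 h3 h2).symm

/-- The normalised function `Φ̃ = Φ` on `{t < 0} ∖ S`, `= k` elsewhere (kits/A1.md item 9) is
measurable, continuous on `{t < 0} ∖ S`, nonnegative, and — `S` being `𝒫¹`-null, so that a.e.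
time slice misses `S` — a.e. slice is `C¹`. [cite: Seregin2020, §3, class 𝒱 (i)–(ii)] -/
theorem normalisedPhi_props {Φ Φ' : ℝ → EuclideanSpace ℝ (Fin 3) → ℝ} {S : Set (ℝ × EuclideanSpace ℝ (Fin 3))} {k R : ℝ}
    (hS : IsClosed S) (hSnull : IsParabolicNull 1 S)
    (hΦc : ContinuousOn (uncurry Φ) ({z : ℝ × EuclideanSpace ℝ (Fin 3) | z.1 < 0} \ S))
    (hΦs : ∀ z : ℝ × EuclideanSpace ℝ (Fin 3), z.1 < 0 → z ∉ S → ContDiffAt ℝ (⊤ : ℕ∞) (Φ z.1) z.2)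
    (hpos : ∀ z : ℝ × EuclideanSpace ℝ (Fin 3), z.1 < 0 → z ∉ S → 0 ≤ Φ z.1 z.2) (hk : 0 < k)
    (hΦ'1 : ∀ t x, t < 0 → (t, x) ∉ S → Φ' t x = Φ t x) (hΦ'2 : ∀ t x, ¬ (t < 0 ∧ (t, x) ∉ S) → Φ' t x = k) :
    Measurable (uncurry Φ') ∧ ContinuousOn (uncurry Φ') ({z : ℝ × EuclideanSpace ℝ (Fin 3) | z.1 < 0} \ S) ∧
      (∀ t x, 0 ≤ Φ' t x) ∧ (∀ᵐ t : ℝ, t ∈ Ioo (-R ^ 2) 0 → ContDiff ℝ 1 (Φ' t)) := by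
  classical
  have hAo : IsOpen ({z : ℝ × EuclideanSpace ℝ (Fin 3) | z.1 < 0} \ S) := (isOpen_lt continuous_fst continuous_const).sdiff hS
  have hEq : EqOn (uncurry Φ') (uncurry Φ) ({z : ℝ × EuclideanSpace ℝ (Fin 3) | z.1 < 0} \ S) := fun z hz => hΦ'1 z.1 z.2 hz.1 hz.2
  have hpw : uncurry Φ' = ({z : ℝ × EuclideanSpace ℝ (Fin 3) | z.1 < 0} \ S).piecewise (uncurry Φ) (fun _ => k) := by
    funext z
    by_cases hz : z ∈ {z : ℝ × EuclideanSpace ℝ (Fin 3) | z.1 < 0} \ S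
    · rw [piecewise_eq_of_mem _ _ _ hz]; exact hEq hz
    · rw [piecewise_eq_of_notMem _ _ _ hz]; exact hΦ'2 z.1 z.2 (fun h => hz ⟨h.1, h.2⟩)
  refine ⟨?_, hΦc.congr hEq, fun t x => ?_, ?_⟩
  · rw [hpw]
    exact ContinuousOn.measurable_piecewise hΦc continuousOn_const hAo.measurableSet
  · by_cases h : t < 0 ∧ (t, x) ∉ S
    · rw [hΦ'1 t x h.1 h.2]; exact hpos (t, x) h.1 h.2
    · rw [hΦ'2 t x h]; exact hk.le
  · filter_upwards [ae_forall_not_mem_of_isParabolicNull hSnull] with t ht htI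
    have hteq : Φ' t = Φ t := funext fun x => hΦ'1 t x htI.2 (ht x)
    rw [hteq]
    exact contDiff_iff_contDiffAt.2 fun x => (hΦs (t, x) htI.2 (ht x)).of_le (by exact_mod_cast le_top)

/-- The normalised drift `Ũ = U` on `{t < 0, ϱ ≠ 0}`, `= 0` elsewhere, is a.e.-strongly measurable
(`U` is continuous on that open set). [folklore] -/
theorem normalisedDrift_aestronglyMeasurable {U U' : ℝ → EuclideanSpace ℝ (Fin 3) → EuclideanSpace ℝ (Fin 3)}
    (hUc : ContinuousOn (uncurry U) {z : ℝ × EuclideanSpace ℝ (Fin 3) | z.1 < 0 ∧ cylRadius z.2 ≠ 0})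
    (hU'1 : ∀ t x, t < 0 → cylRadius x ≠ 0 → U' t x = U t x)
    (hU'2 : ∀ t x, ¬ (t < 0 ∧ cylRadius x ≠ 0) → U' t x = 0) :
    AEStronglyMeasurable (uncurry U') volume := by
  classical
  have hWo : IsOpen {z : ℝ × EuclideanSpace ℝ (Fin 3) | z.1 < 0 ∧ cylRadius z.2 ≠ 0} :=
    (isOpen_lt continuous_fst continuous_const).inter
      (isOpen_ne_fun (continuous_cylRadius.comp continuous_snd) continuous_const)
  have hpw : uncurry U' = {z : ℝ × EuclideanSpace ℝ (Fin 3) | z.1 < 0 ∧ cylRadius z.2 ≠ 0}.piecewise (uncurry U) (fun _ => 0) := by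
    funext z
    by_cases hz : z ∈ {z : ℝ × EuclideanSpace ℝ (Fin 3) | z.1 < 0 ∧ cylRadius z.2 ≠ 0}
    · rw [piecewise_eq_of_mem _ _ _ hz]; exact hU'1 z.1 z.2 hz.1 hz.2
    · rw [piecewise_eq_of_notMem _ _ _ hz]; exact hU'2 z.1 z.2 hz
  rw [hpw]
  exact (ContinuousOn.measurable_piecewise hUc continuousOn_const hWo.measurableSet).aestronglyMeasurable

/-- The superlevel set of `Φ` in the slab is, up to the null set `S`, contained in that of the
normalised `Φ̃` (they agree on `{t < 0} ∖ S ⊇ slab ∖ S`). [folklore] -/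
theorem superlevel_volume_le_normalised {Φ Φ' : ℝ → EuclideanSpace ℝ (Fin 3) → ℝ} {S : Set (ℝ × EuclideanSpace ℝ (Fin 3))} {R κ : ℝ}
    (hSax : ∀ z ∈ S, cylRadius z.2 = 0) (hR : 0 < R)
    (hΦ'1 : ∀ t x, t < 0 → (t, x) ∉ S → Φ' t x = Φ t x) :
    volume {z : ℝ × EuclideanSpace ℝ (Fin 3) | z ∈ Icc (-R ^ 2) (-(3 / 4) * R ^ 2) ×ˢ ball (0 : EuclideanSpace ℝ (Fin 3)) R ∧ κ < Φ z.1 z.2} ≤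
      volume {z : ℝ × EuclideanSpace ℝ (Fin 3) | z ∈ Icc (-R ^ 2) (-(3 / 4) * R ^ 2) ×ˢ ball (0 : EuclideanSpace ℝ (Fin 3)) R ∧ κ < Φ' z.1 z.2} := by
  have hS0 : volume S = 0 := measure_mono_null hSax volume_setOf_cylRadius_snd_eq_zero
  have hsub : {z : ℝ × EuclideanSpace ℝ (Fin 3) | z ∈ Icc (-R ^ 2) (-(3 / 4) * R ^ 2) ×ˢ ball (0 : EuclideanSpace ℝ (Fin 3)) R ∧ κ < Φ z.1 z.2} ⊆
      {z : ℝ × EuclideanSpace ℝ (Fin 3) | z ∈ Icc (-R ^ 2) (-(3 / 4) * R ^ 2) ×ˢ ball (0 : EuclideanSpace ℝ (Fin 3)) R ∧ κ < Φ' z.1 z.2} ∪ S := by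
    intro z hz
    by_cases hzS : z ∈ S
    · exact Or.inr hzS
    · refine Or.inl ⟨hz.1, ?_⟩
      have ht : z.1 < 0 := by
        have h := (mem_prod.1 hz.1).1
        rw [mem_Icc] at h
        linarith [h.2, pow_pos hR 2]
      rw [hΦ'1 z.1 z.2 ht hzS]; exact hz.2
  calc volume {z : ℝ × EuclideanSpace ℝ (Fin 3) | z ∈ Icc (-R ^ 2) (-(3 / 4) * R ^ 2) ×ˢ ball (0 : EuclideanSpace ℝ (Fin 3)) R ∧ κ < Φ z.1 z.2}
      ≤ volume ({z : ℝ × EuclideanSpace ℝ (Fin 3) | z ∈ Icc (-R ^ 2) (-(3 / 4) * R ^ 2) ×ˢ ball (0 : EuclideanSpace ℝ (Fin 3)) R ∧ κ < Φ' z.1 z.2} ∪ S) :=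
        measure_mono hsub
    _ ≤ volume {z : ℝ × EuclideanSpace ℝ (Fin 3) | z ∈ Icc (-R ^ 2) (-(3 / 4) * R ^ 2) ×ˢ ball (0 : EuclideanSpace ℝ (Fin 3)) R ∧ κ < Φ' z.1 z.2} + volume S :=
        measure_union_le _ _
    _ = _ := by rw [hS0, add_zero]

end Summit.NavierStokesRegularity.NavierStokesRegularity.Theorems.AxisymmetricKatoGlobal.EulerScaling

end
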